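import Summits.Ventures.CertifiedArithmetic.Expansions.Orient2d
import Summits.Ventures.CertifiedArithmetic.Expansions.FastExpansionSumPredicates
import Mathlib.Tactic.Linarith
import Mathlib.Tactic.Positivity
import Mathlib.Tactic.Ring
import Mathlib.Tactic.NormNum

/-!
# Weakly nonoverlapping expansions, part 15: ORIENT2D's exact stage with `predicates.c`'s own
# expansion-sum routine (merge order and zero elimination as in the C code)

HONEST FRAMING (ENGINES group, unit `eng-quad-4`, kernels lane of the `certquad` engine — shared
numerical engines serving client cells; rigour lives in the verifiers; every published number
belongs to a client cell's ledger, not to the engines group): NEW WORK of the lane's Lean line, not a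
published result, hence under `Summits/Ventures/` with no citation tag; nothing here is cited anywhere
as a literature fact.  Overview of the development: module docstring of `WeakExpansion.lean`;
ORIENT2D's block structure and the modelling caveats: module docstring of `Orient2d.lean`.

WHAT THIS FILE ADDS.  `Orient2d.lean` proved Theorems 6–7 for the pipeline built on the tree's
FAST-EXPANSION-SUM, whose merge puts the component of `e` first on a tie of magnitudes, and listed as
a modelling caveat that `predicates.c` breaks ties differently.  Part 13
(`FastExpansionSumMergeOrder.lean`) proved FAST-EXPANSION-SUM correct for EVERY admissible merge
order and part 14 (`FastExpansionSumPredicates.lean`) transcribed `predicates.c`'s merge and zero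
elimination and derived the specification of its routine (`fastExpansionSumZeroElimC_spec`).
Here the ORIENT2D theorems are made GENERIC in the expansion-sum routine and then instantiated with
`predicates.c`'s:

* `FesSpec p emin fes` — the specification an expansion-sum-with-zero-elimination routine must meet
  (W-expansions of floats in; a nonempty W-expansion of floats out, exact sum, zero-free or `⟨0⟩`,
  length `≤ max (m + n) 1`); met by the tree's routine (`fesSpec_fastExpansionSumZeroElim`) and by
  `predicates.c`'s (`fesSpec_fastExpansionSumZeroElimC`), for `p ≥ 4` and any round-to-nearest with
  `RoundoffBelow 2`.
* `orient2dExactWith fes tp fl` — Fig. 21's exact stage over any such routine;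
  `orient2dExact tp fl = orient2dExactWith (fastExpansionSumZeroElim fl) tp fl` (`rfl`).
* THEOREM 6″/7″ `orient2dExactWith_spec` / `orient2dExactWith_sign`: the conclusions of Theorems 6–7
  for ANY routine meeting `FesSpec`.
* `orient2dPredicates tp fl := orient2dExactWith (fastExpansionSumZeroElimC fl) tp fl` — the
  arithmetic of `predicates.c`'s `orient2dadapt` (final part) with ITS OWN merge order and zero
  elimination — and its correctness on a round-to-nearest-even machine with Dekker's TWO-PRODUCT
  (`orient2dPredicates_dekker_correct`, the configuration of `predicates.c`: `Split` at
  `s = ⌈p/2⌉` bits, any `s` with `p ≤ 2s ≤ p + 1` is covered) or with an FMA two-product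
  (`orient2dPredicates_fma_correct`).

REMAINING MODELLING CAVEATS (unchanged from `Orient2d.lean`): TWO-DIFF is analysed for roundings
commuting with negation (true for IEEE round-to-nearest-even); overflow is not modelled and underflow
is excluded by the format hypothesis `F(p, e₀)` on the inputs; the floating-point filter stages A–C
of Fig. 21 are not treated (only the exact stage D, which decides the sign on its own).
-/

namespace Summit.Ventures.CertifiedArithmetic.Expansions

open Literature.ComputerArithmetic.JeannerodRump2018
open Literature.ComputerArithmetic.BoldoJeannerodMelquiondMuller2023 hiding twoSum twoSum_fst isFloat_twoSum
open Literature.ComputerArithmetic.Shewchuk1997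

variable {p : ℕ} {emin : ℤ} {fl : ℚ → ℚ}

/-! ## Expansion-sum routines by specification -/

/-- The SPECIFICATION of an expansion-sum routine with zero elimination at precision `p`,
underflow threshold `emin`: on two weakly nonoverlapping expansions of floats it returns a NONEMPTY
weakly nonoverlapping expansion of floats with the exact sum, all of whose components are nonzero
unless it is `⟨0⟩`, of length `≤ max (m + n) 1`. -/
def FesSpec (p : ℕ) (emin : ℤ) (fes : List ℚ → List ℚ → List ℚ) : Prop :=
  ∀ e f : List ℚ, (∀ x ∈ e, IsFloat p emin x) → IsWeakExpansion e →
    (∀ x ∈ f, IsFloat p emin x) → IsWeakExpansion f →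
    IsWeakExpansion (fes e f) ∧ (fes e f).sum = e.sum + f.sum ∧ (∀ x ∈ fes e f, IsFloat p emin x) ∧
      fes e f ≠ [] ∧ ((∀ x ∈ fes e f, x ≠ 0) ∨ fes e f = [0]) ∧
      (fes e f).length ≤ max (e.length + f.length) 1

/-- The tree's FAST-EXPANSION-SUM with zero elimination meets the specification
(`p ≥ 4`, `RoundoffBelow 2` rounding). -/
theorem fesSpec_fastExpansionSumZeroElim (hp : 4 ≤ p) (hfl : IsRoundNearest p emin fl)
    (hfl2 : RoundoffBelow 2 fl) : FesSpec p emin (fastExpansionSumZeroElim fl) :=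
  fun _ _ heF hes hfF hfs => fastExpansionSumZeroElim_spec hp hfl hfl2 heF hes hfF hfs

/-- `predicates.c`'s `fast_expansion_sum_zeroelim` meets the specification
(`p ≥ 4`, `RoundoffBelow 2` rounding). -/
theorem fesSpec_fastExpansionSumZeroElimC (hp : 4 ≤ p) (hfl : IsRoundNearest p emin fl)
    (hfl2 : RoundoffBelow 2 fl) : FesSpec p emin (fastExpansionSumZeroElimC fl) :=
  fun _ _ heF hes hfF hfs => fastExpansionSumZeroElimC_spec hp hfl hfl2 heF hes hfF hfs

/-! ## ORIENT2D's exact stage over an arbitrary expansion-sum routine -/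

/-- Fig. 21's exact stage (`predicates.c` `orient2dadapt`, final part) over an expansion-sum routine
`fes`, a two-product `tp` and a rounding `fl` (block structure: module docstring of `Orient2d.lean`). -/
def orient2dExactWith (fes : List ℚ → List ℚ → List ℚ) (tp : ℚ → ℚ → ℚ × ℚ) (fl : ℚ → ℚ)
    (a₁ a₂ b₁ b₂ c₁ c₂ : ℚ) : List ℚ :=
  let acx := (twoDiff fl a₁ c₁).1
  let acxtail := (twoDiff fl a₁ c₁).2
  let acy := (twoDiff fl a₂ c₂).1
  let acytail := (twoDiff fl a₂ c₂).2
  let bcx := (twoDiff fl b₁ c₁).1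
  let bcxtail := (twoDiff fl b₁ c₁).2
  let bcy := (twoDiff fl b₂ c₂).1
  let bcytail := (twoDiff fl b₂ c₂).2
  let B := twoTwoProdDiff tp fl acx bcy acy bcx
  let C₁ := fes B (twoTwoProdDiff tp fl acxtail bcy acytail bcx)
  let C₂ := fes C₁ (twoTwoProdDiff tp fl acx bcytail acy bcxtail)
  fes C₂ (twoTwoProdDiff tp fl acxtail bcytail acytail bcxtail)

/-- The exact stage of `Orient2d.lean` is the instance `fes = fastExpansionSumZeroElim fl`. -/
theorem orient2dExact_eq_with (tp : ℚ → ℚ → ℚ × ℚ) (fl : ℚ → ℚ) (a₁ a₂ b₁ b₂ c₁ c₂ : ℚ) :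
    orient2dExact tp fl a₁ a₂ b₁ b₂ c₁ c₂ =
      orient2dExactWith (fastExpansionSumZeroElim fl) tp fl a₁ a₂ b₁ b₂ c₁ c₂ := rfl

/-- **THEOREM 6″ (generic exact stage).**  Let `p ≥ 4`, `fl` a round-to-nearest commuting with
negation whose roundoff lies 2-below its result, `fes` ANY routine meeting `FesSpec p emin`, `tp` a
two-product error-free on `F(p, e₀)²`, `emin ≤ e₀`, and the six coordinates in `F(p, e₀)`.  Then
`D = orient2dExactWith fes tp fl …` is a weakly nonoverlapping expansion of at most 16 floats,
nonempty, zero-free unless `D = ⟨0⟩`, with `Σ D = (a₁ − c₁)(b₂ − c₂) − (a₂ − c₂)(b₁ − c₁)` EXACTLY. -/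
theorem orient2dExactWith_spec (hp : 4 ≤ p) (hfl : IsRoundNearest p emin fl)
    (hodd : ∀ t, fl (-t) = -fl t) (hfl2 : RoundoffBelow 2 fl)
    {fes : List ℚ → List ℚ → List ℚ} (hfes : FesSpec p emin fes) {e₀ : ℤ} (he₀ : emin ≤ e₀)
    {tp : ℚ → ℚ → ℚ × ℚ}
    (htp : ∀ x y, IsFloat p e₀ x → IsFloat p e₀ y → ExactTwoProd p emin fl tp x y)
    {a₁ a₂ b₁ b₂ c₁ c₂ : ℚ} (ha₁ : IsFloat p e₀ a₁) (ha₂ : IsFloat p e₀ a₂) (hb₁ : IsFloat p e₀ b₁)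
    (hb₂ : IsFloat p e₀ b₂) (hc₁ : IsFloat p e₀ c₁) (hc₂ : IsFloat p e₀ c₂) :
    IsWeakExpansion (orient2dExactWith fes tp fl a₁ a₂ b₁ b₂ c₁ c₂) ∧
      (orient2dExactWith fes tp fl a₁ a₂ b₁ b₂ c₁ c₂).sum = orient2dDet a₁ a₂ b₁ b₂ c₁ c₂ ∧
      (∀ x ∈ orient2dExactWith fes tp fl a₁ a₂ b₁ b₂ c₁ c₂, IsFloat p emin x) ∧
      orient2dExactWith fes tp fl a₁ a₂ b₁ b₂ c₁ c₂ ≠ [] ∧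
      ((∀ x ∈ orient2dExactWith fes tp fl a₁ a₂ b₁ b₂ c₁ c₂, x ≠ 0) ∨
        orient2dExactWith fes tp fl a₁ a₂ b₁ b₂ c₁ c₂ = [0]) ∧
      (orient2dExactWith fes tp fl a₁ a₂ b₁ b₂ c₁ c₂).length ≤ 16 := by
  have hp1 : 1 ≤ p := le_trans (by norm_num) hp
  obtain ⟨fxa, fxat, sxa⟩ := twoDiff_coarse hp1 hfl hodd he₀ ha₁ hc₁
  obtain ⟨fya, fyat, sya⟩ := twoDiff_coarse hp1 hfl hodd he₀ ha₂ hc₂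
  obtain ⟨fxb, fxbt, sxb⟩ := twoDiff_coarse hp1 hfl hodd he₀ hb₁ hc₁
  obtain ⟨fyb, fybt, syb⟩ := twoDiff_coarse hp1 hfl hodd he₀ hb₂ hc₂
  -- the four blocks `B, u₁, u₂, u₃`
  obtain ⟨WB, SB, LB, FB⟩ := twoTwoProdDiff_spec hp1 hfl hfl2 (htp _ _ fxa fyb) (htp _ _ fya fxb)
  obtain ⟨W1, S1, L1, F1⟩ := twoTwoProdDiff_spec hp1 hfl hfl2 (htp _ _ fxat fyb) (htp _ _ fyat fxb)
  obtain ⟨W2, S2, L2, F2⟩ := twoTwoProdDiff_spec hp1 hfl hfl2 (htp _ _ fxa fybt) (htp _ _ fya fxbt)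
  obtain ⟨W3, S3, L3, F3⟩ :=
    twoTwoProdDiff_spec hp1 hfl hfl2 (htp _ _ fxat fybt) (htp _ _ fyat fxbt)
  -- the three zero-eliminated expansion sums `C₁, C₂, D`
  obtain ⟨WC1, SC1, FC1, -, -, LC1⟩ := hfes _ _ FB WB F1 W1
  obtain ⟨WC2, SC2, FC2, -, -, LC2⟩ := hfes _ _ FC1 WC1 F2 W2
  obtain ⟨WD, SD, FD, ND, ZD, LD⟩ := hfes _ _ FC2 WC2 F3 W3
  have hdef : orient2dExactWith fes tp fl a₁ a₂ b₁ b₂ c₁ c₂ =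
      fes (fes (fes
        (twoTwoProdDiff tp fl (twoDiff fl a₁ c₁).1 (twoDiff fl b₂ c₂).1 (twoDiff fl a₂ c₂).1
          (twoDiff fl b₁ c₁).1)
        (twoTwoProdDiff tp fl (twoDiff fl a₁ c₁).2 (twoDiff fl b₂ c₂).1 (twoDiff fl a₂ c₂).2
          (twoDiff fl b₁ c₁).1))
        (twoTwoProdDiff tp fl (twoDiff fl a₁ c₁).1 (twoDiff fl b₂ c₂).2 (twoDiff fl a₂ c₂).1
          (twoDiff fl b₁ c₁).2))
        (twoTwoProdDiff tp fl (twoDiff fl a₁ c₁).2 (twoDiff fl b₂ c₂).2 (twoDiff fl a₂ c₂).2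
          (twoDiff fl b₁ c₁).2) := rfl
  rw [hdef]
  refine ⟨WD, ?_, FD, ND, ZD, ?_⟩
  · rw [SD, SC2, SC1, SB, S1, S2, S3, orient2dDet, ← sxa, ← sya, ← sxb, ← syb]
    ring
  · have h1 : _ ≤ max (4 + 4) 1 := le_trans LC1 (by rw [LB, L1])
    have h2 := le_trans LC2 (max_le_max (Nat.add_le_add h1 L2.le) le_rfl)
    exact le_trans LD (le_trans (max_le_max (Nat.add_le_add h2 L3.le) le_rfl) (by norm_num))

/-- **THEOREM 7″ (generic sign test).**  Under the hypotheses of Theorem 6″, `D` is nonempty and its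
last component decides the sign of the determinant: `det > 0 ↔ D[last] > 0`, `det < 0 ↔ D[last] < 0`,
`det = 0 ↔ D = ⟨0⟩`. -/
theorem orient2dExactWith_sign (hp : 4 ≤ p) (hfl : IsRoundNearest p emin fl)
    (hodd : ∀ t, fl (-t) = -fl t) (hfl2 : RoundoffBelow 2 fl)
    {fes : List ℚ → List ℚ → List ℚ} (hfes : FesSpec p emin fes) {e₀ : ℤ} (he₀ : emin ≤ e₀)
    {tp : ℚ → ℚ → ℚ × ℚ}
    (htp : ∀ x y, IsFloat p e₀ x → IsFloat p e₀ y → ExactTwoProd p emin fl tp x y)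
    {a₁ a₂ b₁ b₂ c₁ c₂ : ℚ} (ha₁ : IsFloat p e₀ a₁) (ha₂ : IsFloat p e₀ a₂) (hb₁ : IsFloat p e₀ b₁)
    (hb₂ : IsFloat p e₀ b₂) (hc₁ : IsFloat p e₀ c₁) (hc₂ : IsFloat p e₀ c₂) :
    ∃ hD : orient2dExactWith fes tp fl a₁ a₂ b₁ b₂ c₁ c₂ ≠ [],
      (0 < orient2dDet a₁ a₂ b₁ b₂ c₁ c₂ ↔
          0 < (orient2dExactWith fes tp fl a₁ a₂ b₁ b₂ c₁ c₂).getLast hD) ∧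
        (orient2dDet a₁ a₂ b₁ b₂ c₁ c₂ < 0 ↔
          (orient2dExactWith fes tp fl a₁ a₂ b₁ b₂ c₁ c₂).getLast hD < 0) ∧
        (orient2dDet a₁ a₂ b₁ b₂ c₁ c₂ = 0 ↔
          orient2dExactWith fes tp fl a₁ a₂ b₁ b₂ c₁ c₂ = [0]) := by
  obtain ⟨hW, hS, hF, hne, hZ, -⟩ :=
    orient2dExactWith_spec hp hfl hodd hfl2 hfes he₀ htp ha₁ ha₂ hb₁ hb₂ hc₁ hc₂
  refine ⟨hne, ?_⟩
  rw [← hS]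
  rcases hZ with hnz | h0
  · obtain ⟨h1, h2, h3⟩ :=
      sign_sum_of_getLast_ne_zero hF hW.isExpansion hne (hnz _ (List.getLast_mem hne))
    refine ⟨h1, h2, ⟨fun h => absurd h h3, fun h => ?_⟩⟩
    exfalso
    rw [h] at hnz
    exact hnz 0 (List.mem_singleton_self 0) rfl
  · have key : ∀ (L : List ℚ) (h : L ≠ []), L = [0] → L.getLast h = 0 ∧ L.sum = 0 := by
      rintro L h rfl; exact ⟨rfl, by simp⟩
    obtain ⟨hl, hs0⟩ := key _ hne h0
    rw [hl, hs0]
    exact ⟨Iff.rfl, Iff.rfl, ⟨fun _ => h0, fun _ => rfl⟩⟩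

/-! ## `predicates.c`'s arithmetic -/

/-- **The exact stage of `predicates.c`'s `orient2dadapt`** with the C code's own
`fast_expansion_sum_zeroelim` (its merge order `takeE`, zero elimination), over a two-product `tp`
and a rounding `fl`. -/
def orient2dPredicates (tp : ℚ → ℚ → ℚ × ℚ) (fl : ℚ → ℚ) (a₁ a₂ b₁ b₂ c₁ c₂ : ℚ) : List ℚ :=
  orient2dExactWith (fastExpansionSumZeroElimC fl) tp fl a₁ a₂ b₁ b₂ c₁ c₂

/-- **`predicates.c`'s ORIENT2D exact stage IS CORRECT (round-to-nearest-even, Dekker's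
TWO-PRODUCT with a split point `s`, `p ≤ 2s ≤ p + 1` — `predicates.c` uses `s = ⌈p/2⌉` — `p ≥ 4`)**:
for input coordinates in `F(p, e₀)` with `e₀ ≥ emin + p − 1` and `2e₀ ≥ emin + 2p − 1` (no
underflow anywhere), `D` is a weakly nonoverlapping expansion of floats with `Σ D = det` EXACTLY, and
`D[Dlength − 1]`, the value the C function returns, has the sign of
`det = (a₁ − c₁)(b₂ − c₂) − (a₂ − c₂)(b₁ − c₁)`; `det = 0 ↔ D = ⟨0⟩` (returned value `0`). -/
theorem orient2dPredicates_dekker_correct (hp : 4 ≤ p) {s : ℕ} (hs2 : p ≤ 2 * s)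
    (hs2' : 2 * s ≤ p + 1) {e₀ : ℤ} (h1 : emin + p - 1 ≤ e₀) (h2 : emin + 2 * p - 1 ≤ e₀ + e₀)
    {a₁ a₂ b₁ b₂ c₁ c₂ : ℚ} (ha₁ : IsFloat p e₀ a₁) (ha₂ : IsFloat p e₀ a₂) (hb₁ : IsFloat p e₀ b₁)
    (hb₂ : IsFloat p e₀ b₂) (hc₁ : IsFloat p e₀ c₁) (hc₂ : IsFloat p e₀ c₂) :
    let D := orient2dPredicates (twoProduct (roundTiesEven p emin) s) (roundTiesEven p emin)
      a₁ a₂ b₁ b₂ c₁ c₂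
    IsWeakExpansion D ∧ D.sum = orient2dDet a₁ a₂ b₁ b₂ c₁ c₂ ∧ (∀ x ∈ D, IsFloat p emin x) ∧
      ∃ hD : D ≠ [],
        (0 < orient2dDet a₁ a₂ b₁ b₂ c₁ c₂ ↔ 0 < D.getLast hD) ∧
          (orient2dDet a₁ a₂ b₁ b₂ c₁ c₂ < 0 ↔ D.getLast hD < 0) ∧
          (orient2dDet a₁ a₂ b₁ b₂ c₁ c₂ = 0 ↔ D = [0]) := by
  intro D
  have hp1 : 1 ≤ p := le_trans (by norm_num) hp
  have he₀ : emin ≤ e₀ := by omega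
  have hfl : IsRoundNearest p emin (roundTiesEven p emin) := isRoundNearest_roundTiesEven hp1
  have hodd : ∀ t, roundTiesEven p emin (-t) = -roundTiesEven p emin t :=
    Literature.ComputerArithmetic.GraillatMuller2025.roundTiesEven_neg
  have hfl2 : RoundoffBelow 2 (roundTiesEven p emin) := roundoffBelow_two_roundTiesEven p emin
  have hfes := fesSpec_fastExpansionSumZeroElimC hp hfl hfl2
  have htp : ∀ x y, IsFloat p e₀ x → IsFloat p e₀ y →
      ExactTwoProd p emin (roundTiesEven p emin) (twoProduct (roundTiesEven p emin) s) x y :=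
    fun x y hx hy => exactTwoProd_twoProduct hp hs2 hs2' hfl hodd h1 h2 hx hy
  obtain ⟨hW, hS, hF, -, -, -⟩ :=
    orient2dExactWith_spec hp hfl hodd hfl2 hfes he₀ htp ha₁ ha₂ hb₁ hb₂ hc₁ hc₂
  exact ⟨hW, hS, hF, orient2dExactWith_sign hp hfl hodd hfl2 hfes he₀ htp ha₁ ha₂ hb₁ hb₂ hc₁ hc₂⟩

/-- The same with an FMA two-product (`2Prod_FMA`) in place of Dekker's: input coordinates in
`F(p, e₀)` with `emin ≤ e₀` and `emin ≤ 2e₀` (binary64: multiples of `2^−537`). -/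
theorem orient2dPredicates_fma_correct (hp : 4 ≤ p) {e₀ : ℤ} (he₀ : emin ≤ e₀)
    (h2 : emin ≤ e₀ + e₀)
    {a₁ a₂ b₁ b₂ c₁ c₂ : ℚ} (ha₁ : IsFloat p e₀ a₁) (ha₂ : IsFloat p e₀ a₂) (hb₁ : IsFloat p e₀ b₁)
    (hb₂ : IsFloat p e₀ b₂) (hc₁ : IsFloat p e₀ c₁) (hc₂ : IsFloat p e₀ c₂) :
    let D := orient2dPredicates (twoProdFMA (roundTiesEven p emin)) (roundTiesEven p emin)
      a₁ a₂ b₁ b₂ c₁ c₂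
    IsWeakExpansion D ∧ D.sum = orient2dDet a₁ a₂ b₁ b₂ c₁ c₂ ∧ (∀ x ∈ D, IsFloat p emin x) ∧
      ∃ hD : D ≠ [],
        (0 < orient2dDet a₁ a₂ b₁ b₂ c₁ c₂ ↔ 0 < D.getLast hD) ∧
          (orient2dDet a₁ a₂ b₁ b₂ c₁ c₂ < 0 ↔ D.getLast hD < 0) ∧
          (orient2dDet a₁ a₂ b₁ b₂ c₁ c₂ = 0 ↔ D = [0]) := by
  intro D
  have hp1 : 1 ≤ p := le_trans (by norm_num) hp
  have hfl : IsRoundNearest p emin (roundTiesEven p emin) := isRoundNearest_roundTiesEven hp1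
  have hodd : ∀ t, roundTiesEven p emin (-t) = -roundTiesEven p emin t :=
    Literature.ComputerArithmetic.GraillatMuller2025.roundTiesEven_neg
  have hfl2 : RoundoffBelow 2 (roundTiesEven p emin) := roundoffBelow_two_roundTiesEven p emin
  have hfes := fesSpec_fastExpansionSumZeroElimC hp hfl hfl2
  have htp : ∀ x y, IsFloat p e₀ x → IsFloat p e₀ y →
      ExactTwoProd p emin (roundTiesEven p emin) (twoProdFMA (roundTiesEven p emin)) x y :=
    fun x y hx hy => exactTwoProd_twoProdFMA hp1 hfl h2 hx hy
  obtain ⟨hW, hS, hF, -, -, -⟩ :=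
    orient2dExactWith_spec hp hfl hodd hfl2 hfes he₀ htp ha₁ ha₂ hb₁ hb₂ hc₁ hc₂
  exact ⟨hW, hS, hF, orient2dExactWith_sign hp hfl hodd hfl2 hfes he₀ htp ha₁ ha₂ hb₁ hb₂ hc₁ hc₂⟩

end Summit.Ventures.CertifiedArithmetic.Expansions
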